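import Literature.Geometry.Lorentzian.GaussEquationFrame
import Literature.Geometry.Lorentzian.LeviCivitaCovDerivProofs
import Literature.Geometry.Lorentzian.TracedGaussEquation
import Literature.Geometry.Lorentzian.CurvatureRegularity
import Literature.Analysis.Calculus.MatrixFieldDeriv
import HarnessLib

/-!
# The derivative of the metric trace of a field of bilinear forms

For a pseudo-Riemannian metric `g` with Levi-Civita connection `∇` and a differentiable field
`k` of bilinear forms, the metric trace commutes with covariant differentiation:
`v(tr_g k) = tr_g(∇_v k)` (O'Neill 1983, Ch. 3, p. 86: contraction commutes with tensor
derivations, Prop. 3.18 / Cor. 3.13 with `∇g = 0`). In an orthogonal basis `β` of `T_{x₀}M` with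
`aᵢ = g(βᵢ, βᵢ) ≠ 0` this reads `d(tr_g k)(v) = ∑ᵢ (∇_v k)(βᵢ, βᵢ)/aᵢ`. This is the step
`d(tr K) = tr(∇K)` in the derivation of the momentum constraint `div K − d(tr K) = Ric(ν, ·)`
from the Codazzi equation (Wald 1984, (10.2.29); Choquet-Bruhat 2009, Ch. VI, (3.11)).

* `PseudoRiemannianMetric.mdifferentiableAt_and_mvfderiv_trace_localFrame` —
  **`∂_d (tr_g k) = ∑ᵢ (∇_{∂_d} k)(βᵢ, βᵢ)/aᵢ`** at `x₀`, for the coordinate direction `∂_d` of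
  the chart at `x₀` built on the orthogonal basis `β` (`covDeriv₂`, derivative slot last), and
  `y ↦ tr_g k_y` is differentiable at `x₀`.

Proof (a coordinate computation, O'Neill Ch. 3, pp. 60–61 and 65–66): near `x₀`,
`tr_g k = ∑ᵢⱼ (G⁻¹)ⱼᵢ k(∂ᵢ, ∂ⱼ)` in the coordinate frame `∂ᵢ` with Gram matrix `G`
(`trace_eq_sum_gram_inv`); read in the chart this is a sum of products of differentiable
functions (`hasFDerivAt_inv_apply` for `G⁻¹`), and at `x₀`, where `G = diag(aᵢ)`,
`∂_d Gᵢⱼ = g(∇_{∂_d}∂ᵢ, ∂ⱼ) + g(∂ᵢ, ∇_{∂_d}∂ⱼ)` (compatibility),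
`∂_d k(∂ᵢ,∂ⱼ) = (∇_{∂_d}k)(∂ᵢ,∂ⱼ) + k(∇_{∂_d}∂ᵢ, ∂ⱼ) + k(∂ᵢ, ∇_{∂_d}∂ⱼ)` (`covDeriv₂_apply_holds`),
and after expanding `∇_{∂_d}∂ᵢ = ∑ₗ g(∇_{∂_d}∂ᵢ, βₗ)/aₗ βₗ` all terms not involving `∇k` cancel
(`trace_deriv_algebra`).

Everything is proved; there are no definitions and no named facts.

## References

* B. O'Neill, *Semi-Riemannian geometry with applications to relativity*, Academic Press 1983,
  Ch. 3, pp. 60–61 (metric contraction), Def. 3.16–3.17, Prop. 3.18, p. 86 (contraction and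
  tensor derivations commute). [ONeill1983]
* R. M. Wald, *General Relativity*, Chicago 1984, (10.2.29). [Wald1984]
-/

noncomputable section

open Bundle Set Filter Function Manifold
open scoped Manifold ContDiff Topology Matrix

namespace Literature.Geometry.Lorentzian

namespace PseudoRiemannianMetric

/-! ### The cancellation behind `d(tr k) = tr(∇k)` -/

/-- **The algebra of `d(tr k) = tr(∇k)` in an orthogonal frame.** With `aᵢ` the metric
coefficients, `Kᵢⱼ = k(βᵢ, βⱼ)`, `Cᵢⱼ = (∇_v k)(βᵢ, βⱼ)` and `Γᵢₗ = g(∇_v ∂ᵢ, βₗ)`: the derivative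
`∑ₖₗ [∂(G⁻¹)ₗₖ Kₖₗ + (G⁻¹)ₗₖ ∂Kₖₗ]` of `∑ₖₗ (G⁻¹)ₗₖ Kₖₗ`, with `G⁻¹ = diag(aᵢ⁻¹)`,
`∂(G⁻¹)ₗₖ = −(Γₗₖ + Γₖₗ)/(aₗ aₖ)` and `∂Kₖₗ = Cₖₗ + ∑ₘ Γₖₘ Kₘₗ/aₘ + ∑ₘ Γₗₘ Kₖₘ/aₘ`, equals
`∑ₖ Cₖₖ/aₖ`. [folklore] -/
theorem trace_deriv_algebra {ι : Type*} [Fintype ι] [DecidableEq ι] (a : ι → ℝ)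
    (C K Γ : ι → ι → ℝ) :
    ∑ k, ∑ l, (-((a l)⁻¹ * (a k)⁻¹ * (Γ l k + Γ k l)) * K k l +
      Matrix.diagonal (fun i ↦ (a i)⁻¹) l k *
        (C k l + ∑ m, Γ k m / a m * K m l + ∑ m, Γ l m / a m * K k m)) =
    ∑ k, C k k / a k := by
  -- the diagonal part
  have hdiag : ∀ k, ∑ l, Matrix.diagonal (fun i ↦ (a i)⁻¹) l k *
      (C k l + ∑ m, Γ k m / a m * K m l + ∑ m, Γ l m / a m * K k m) =
      (a k)⁻¹ * (C k k + ∑ m, Γ k m / a m * K m k + ∑ m, Γ k m / a m * K k m) := by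
    intro k
    rw [Finset.sum_eq_single k]
    · rw [Matrix.diagonal_apply_eq]
    · intro l _ hlk
      rw [Matrix.diagonal_apply_ne _ hlk, zero_mul]
    · intro h
      exact absurd (Finset.mem_univ k) h
  have hsplit : ∀ k, ∑ l, (-((a l)⁻¹ * (a k)⁻¹ * (Γ l k + Γ k l)) * K k l +
      Matrix.diagonal (fun i ↦ (a i)⁻¹) l k *
        (C k l + ∑ m, Γ k m / a m * K m l + ∑ m, Γ l m / a m * K k m)) =
      (∑ l, -((a l)⁻¹ * (a k)⁻¹ * (Γ l k + Γ k l)) * K k l) +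
        (a k)⁻¹ * (C k k + ∑ m, Γ k m / a m * K m k + ∑ m, Γ k m / a m * K k m) := by
    intro k
    rw [Finset.sum_add_distrib, hdiag]
  simp_rw [hsplit]
  rw [Finset.sum_add_distrib]
  -- the two cross sums cancel against the expansion terms
  have h1 : ∑ k, ∑ l, -((a l)⁻¹ * (a k)⁻¹ * (Γ l k + Γ k l)) * K k l =
      -(∑ k, ∑ l, (a l)⁻¹ * (a k)⁻¹ * Γ l k * K k l) -
        ∑ k, ∑ l, (a l)⁻¹ * (a k)⁻¹ * Γ k l * K k l := by
    simp only [neg_mul, Finset.sum_neg_distrib, add_mul, mul_add, Finset.sum_add_distrib]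
    ring
  have h2 : ∑ k, (a k)⁻¹ * (C k k + ∑ m, Γ k m / a m * K m k + ∑ m, Γ k m / a m * K k m) =
      ∑ k, C k k / a k + ∑ k, ∑ m, (a m)⁻¹ * (a k)⁻¹ * Γ k m * K m k +
        ∑ k, ∑ m, (a m)⁻¹ * (a k)⁻¹ * Γ k m * K k m := by
    simp only [mul_add, Finset.sum_add_distrib, Finset.mul_sum, div_eq_mul_inv]
    congr 1
    · congr 1
      · refine Finset.sum_congr rfl fun k _ ↦ ?_
        ring
      · refine Finset.sum_congr rfl fun k _ ↦ Finset.sum_congr rfl fun m _ ↦ ?_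
        ring
    · refine Finset.sum_congr rfl fun k _ ↦ Finset.sum_congr rfl fun m _ ↦ ?_
      ring
  rw [h1, h2]
  have h3 : ∑ k, ∑ l, (a l)⁻¹ * (a k)⁻¹ * Γ l k * K k l =
      ∑ k, ∑ m, (a m)⁻¹ * (a k)⁻¹ * Γ k m * K m k := by
    rw [Finset.sum_comm]
    refine Finset.sum_congr rfl fun k _ ↦ Finset.sum_congr rfl fun m _ ↦ ?_
    ring
  rw [h3]
  ring


/-- `∑ₚ ∑_q diag(c)ⱼₚ diag(c)_qᵢ Xₚ_q = cⱼ cᵢ Xⱼᵢ` (the derivative `−G⁻¹ (∂G) G⁻¹` of the inverse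
Gram matrix when `G⁻¹ = diag(c)`). [folklore] -/
theorem sum_sum_diagonal_mul {ι : Type*} [Fintype ι] [DecidableEq ι] (c : ι → ℝ)
    (X : ι → ι → ℝ) (j i : ι) :
    ∑ p, ∑ q, Matrix.diagonal c j p * Matrix.diagonal c q i * X p q = c j * c i * X j i := by
  rw [Finset.sum_eq_single j]
  · rw [Finset.sum_eq_single i]
    · rw [Matrix.diagonal_apply_eq, Matrix.diagonal_apply_eq]
    · intro q _ hq
      rw [Matrix.diagonal_apply_ne _ hq, mul_zero, zero_mul]
    · intro h
      exact absurd (Finset.mem_univ i) h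
  · intro p _ hp
    simp only [Matrix.diagonal_apply_ne _ (Ne.symm hp), zero_mul, Finset.sum_const_zero]
  · intro h
    exact absurd (Finset.mem_univ j) h

/-! ### Differentiability and the derivative of the trace -/

section Trace

variable {E : Type*} [NormedAddCommGroup E] [NormedSpace ℝ E] {H : Type*} [TopologicalSpace H]
  {I : ModelWithCorners ℝ E H} {M : Type*} [TopologicalSpace M] [ChartedSpace H M]
  [IsManifold I ∞ M] [FiniteDimensional ℝ E] [CompleteSpace E] [I.Boundaryless]
  (g : PseudoRiemannianMetric I ∞ E (TangentSpace I : M → Type _)) [g.HasLeviCivita]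
  {ι : Type*} [Fintype ι] [DecidableEq ι] (β : Module.Basis ι ℝ E) {x₀ : M}
  {k : Π y : M, TangentSpace I y →L[ℝ] TangentSpace I y →L[ℝ] ℝ}

omit [CompleteSpace E] [I.Boundaryless] [g.HasLeviCivita] in
/-- **The metric trace in the coordinate frame**: at a point `y` of the chart domain of `x₀`,
`tr_g k_y = ∑ᵢⱼ (G(y)⁻¹)ⱼᵢ k_y(∂ᵢ, ∂ⱼ)` with `∂ᵢ` the coordinate frame of the chart at `x₀` built
on the basis `β` and `G(y)` its Gram matrix (`trace_eq_sum_gram_inv` for the basis `∂ᵢ|_y`).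
O'Neill 1983, Ch. 3, pp. 60–61. [cite: ONeill1983, Ch. 3, pp. 60–61] -/
theorem trace_eq_sum_gram_inv_localFrame {y : M}
    (hy : y ∈ (trivializationAt E (TangentSpace I) x₀).baseSet) :
    g.trace y (k y).toLinearMap₁₂ =
      ∑ i, ∑ j, (Matrix.of fun i j ↦ g.val y ((trivializationAt E (TangentSpace I) x₀).localFrame β
          i y) ((trivializationAt E (TangentSpace I) x₀).localFrame β j y))⁻¹ j i * k y
          ((trivializationAt E (TangentSpace I) x₀).localFrame β i y) ((trivializationAt E
          (TangentSpace I) x₀).localFrame β j y) := by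
  rw [trace_eq_sum_gram_inv g y ((trivializationAt E (TangentSpace I) x₀).basisAt β hy)]
  simp only [Trivialization.localFrame_apply_of_mem_baseSet _ _ hy]
  rfl

/-- **`d(tr_g k) = tr_g(∇k)` on a coordinate direction, with differentiability.** Let `k` be a
field of continuous bilinear forms on `TM`, differentiable at `x₀` as a section of
`Hom(TM, Hom(TM, ℝ))`, and let `∂ᵢ` be the coordinate frame of the chart at `x₀` built on a basis
`β` of the model space, assumed `g_{x₀}`-orthogonal at `x₀` with `aᵢ = g(∂ᵢ, ∂ᵢ)(x₀) ≠ 0`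
(`∂ᵢ|_{x₀} = βᵢ`, `localFrame_trivializationAt_self`). Then `y ↦ tr_g k_y` is differentiable at
`x₀` and `∂_d(tr_g k)(x₀) = ∑ᵢ (∇_{∂_d} k)(∂ᵢ, ∂ᵢ)(x₀)/aᵢ` (`covDeriv₂ k x₀ ∂ᵢ ∂ᵢ ∂_d`,
derivative slot last). O'Neill 1983, Ch. 3, p. 86 (contractions commute with tensor derivations)
with `∇g = 0` (Cor. 3.13); proof: see the module docstring.
[cite: ONeill1983, Ch. 3, Prop. 3.18 and p. 86] -/
theorem mdifferentiableAt_and_mvfderiv_trace_localFrame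
    (hk : MDifferentiableAt I (I.prod 𝓘(ℝ, E →L[ℝ] E →L[ℝ] ℝ))
      (fun y ↦ TotalSpace.mk' (E →L[ℝ] E →L[ℝ] ℝ)
        (E := fun y : M ↦ TangentSpace I y →L[ℝ] TangentSpace I y →L[ℝ] ℝ) y (k y)) x₀)
    (hβ : (g.toBilinForm x₀).IsOrthoᵢ fun i ↦ (trivializationAt E (TangentSpace I) x₀).localFrame β
        i x₀)
    (hdβ : ∀ i, g.val x₀ ((trivializationAt E (TangentSpace I) x₀).localFrame β i x₀)
        ((trivializationAt E (TangentSpace I) x₀).localFrame β i x₀) ≠ 0) (d : ι) :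
    MDifferentiableAt I 𝓘(ℝ, ℝ) (fun y ↦ g.trace y (k y).toLinearMap₁₂) x₀ ∧
      mvfderiv I (fun y ↦ g.trace y (k y).toLinearMap₁₂) x₀ ((trivializationAt E (TangentSpace I)
          x₀).localFrame β d x₀) =
        ∑ i, g.covDeriv₂ k x₀ ((trivializationAt E (TangentSpace I) x₀).localFrame β i x₀)
            ((trivializationAt E (TangentSpace I) x₀).localFrame β i x₀) ((trivializationAt E
            (TangentSpace I) x₀).localFrame β d x₀) / g.val x₀ ((trivializationAt E (TangentSpace
            I) x₀).localFrame β i x₀) ((trivializationAt E (TangentSpace I) x₀).localFrame β i x₀)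
            := by
  have hx₀ : x₀ ∈ (chartAt H x₀).source := mem_chart_source H x₀
  have hx₀e : x₀ ∈ (trivializationAt E (TangentSpace I) x₀).baseSet :=
    FiberBundle.mem_baseSet_trivializationAt' x₀
  have hz : extChartAt I x₀ x₀ ∈ (extChartAt I x₀).target := mem_extChartAt_target x₀
  have hxinv : ((extChartAt I x₀).symm (extChartAt I x₀ x₀)) = x₀ := extChartAt_to_inv x₀
  have hI1 : IsManifold I (1 + 1) M := inferInstanceAs (IsManifold I 2 M)
  have hVB1 : ContMDiffVectorBundle 1 E (TangentSpace I : M → Type _) I :=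
    TangentBundle.contMDiffVectorBundle
  have hs : ∀ i, MDiffAt (T% ((trivializationAt E (TangentSpace I) x₀).localFrame β i)) x₀ := fun i
      ↦
    (contMDiffAt_localFrame_of_mem 1 (trivializationAt E (TangentSpace I) x₀) β i
      hx₀e).mdifferentiableAt one_ne_zero
  have hcompat := (isLeviCivita_leviCivita_holds (g := g)).2
  -- the frame at `x₀` as a basis of `T_{x₀}M`
  have hbx : ∀ i, (trivializationAt E (TangentSpace I) x₀).basisAt β hx₀e i = (trivializationAt E
      (TangentSpace I) x₀).localFrame β i x₀ := fun i ↦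
    (Trivialization.localFrame_apply_of_mem_baseSet _ _ hx₀e).symm
  have hbxf : ⇑((trivializationAt E (TangentSpace I) x₀).basisAt β hx₀e) = fun i ↦
      (trivializationAt E (TangentSpace I) x₀).localFrame β i x₀ :=
    funext hbx
  have hβ' : (g.toBilinForm x₀).IsOrthoᵢ ((trivializationAt E (TangentSpace I) x₀).basisAt β hx₀e)
      := by
    rw [hbxf]; exact hβ
  have hdβ' : ∀ i, g.val x₀ ((trivializationAt E (TangentSpace I) x₀).basisAt β hx₀e i)
      ((trivializationAt E (TangentSpace I) x₀).basisAt β hx₀e i) ≠ 0 := fun i ↦ by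
    rw [hbx]; exact hdβ i
  -- the Gram entries and the `k`-entries as functions on `M`, differentiable at `x₀`
  have hG : ∀ i j, MDifferentiableAt I 𝓘(ℝ, ℝ) (fun y ↦ g.val y ((trivializationAt E (TangentSpace
      I) x₀).localFrame β i y) ((trivializationAt E (TangentSpace I) x₀).localFrame β j y)) x₀ :=
    fun i j ↦ g.mdifferentiableAt_val_apply (hs i) (hs j)
  have hκ : ∀ i j, MDifferentiableAt I 𝓘(ℝ, ℝ) (fun y ↦ k y ((trivializationAt E (TangentSpace I)
      x₀).localFrame β i y) ((trivializationAt E (TangentSpace I) x₀).localFrame β j y)) x₀ :=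
    fun i j ↦ mdifferentiableAt_bilin_apply hk (hs i) (hs j)
  -- read in the chart at `x₀`
  have h1s : ContMDiffAt 𝓘(ℝ, E) I ∞ (extChartAt I x₀).symm (extChartAt I x₀ x₀) :=
    (contMDiffOn_extChartAt_symm x₀).contMDiffAt ((isOpen_extChartAt_target x₀).mem_nhds hz)
  have hsymm : MDifferentiableAt 𝓘(ℝ, E) I (extChartAt I x₀).symm (extChartAt I x₀ x₀) :=
    h1s.mdifferentiableAt (by simp)
  have hGE : ∀ i j, DifferentiableAt ℝ
      ((fun y ↦ g.val y ((trivializationAt E (TangentSpace I) x₀).localFrame β i y)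
          ((trivializationAt E (TangentSpace I) x₀).localFrame β j y)) ∘ (extChartAt I x₀).symm)
          (extChartAt I x₀ x₀) := by
    intro i j
    refine mdifferentiableAt_iff_differentiableAt.1 (MDifferentiableAt.comp _ ?_ hsymm)
    rw [hxinv]; exact hG i j
  have hκE : ∀ i j, DifferentiableAt ℝ
      ((fun y ↦ k y ((trivializationAt E (TangentSpace I) x₀).localFrame β i y) ((trivializationAt
          E (TangentSpace I) x₀).localFrame β j y)) ∘ (extChartAt I x₀).symm) (extChartAt I x₀ x₀)
          := by
    intro i j
    refine mdifferentiableAt_iff_differentiableAt.1 (MDifferentiableAt.comp _ ?_ hsymm)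
    rw [hxinv]; exact hκ i j
  -- the Gram matrix field in the chart and its derivative
  have hA : HasFDerivAt
      (fun z i j ↦ ((fun y ↦ g.val y ((trivializationAt E (TangentSpace I) x₀).localFrame β i y)
          ((trivializationAt E (TangentSpace I) x₀).localFrame β j y)) ∘ (extChartAt I x₀).symm) z)
      (ContinuousLinearMap.pi fun i ↦ ContinuousLinearMap.pi fun j ↦
        fderiv ℝ ((fun y ↦ g.val y ((trivializationAt E (TangentSpace I) x₀).localFrame β i y)
            ((trivializationAt E (TangentSpace I) x₀).localFrame β j y)) ∘ (extChartAt I x₀).symm)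
          (extChartAt I x₀ x₀)) (extChartAt I x₀ x₀) :=
    hasFDerivAt_pi.2 fun i ↦ hasFDerivAt_pi.2 fun j ↦ (hGE i j).hasFDerivAt
  -- at `x₀` the Gram matrix is that of the frame: invertible, with diagonal inverse
  have hA0 : (fun i j ↦ ((fun y ↦ g.val y ((trivializationAt E (TangentSpace I) x₀).localFrame β i
      y) ((trivializationAt E (TangentSpace I) x₀).localFrame β j y)) ∘ (extChartAt I x₀).symm)
      (extChartAt I x₀ x₀)) = fun i j ↦ g.val x₀ ((trivializationAt E (TangentSpace I)
          x₀).localFrame β i x₀) ((trivializationAt E (TangentSpace I) x₀).localFrame β j x₀) := by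
    funext i j
    simp only [Function.comp_apply]
    rw [hxinv]
  have hdet : (Matrix.of fun i j ↦ ((fun y ↦ g.val y ((trivializationAt E (TangentSpace I)
      x₀).localFrame β i y) ((trivializationAt E (TangentSpace I) x₀).localFrame β j y)) ∘
      (extChartAt I x₀).symm)
      (extChartAt I x₀ x₀)).det ≠ 0 := by
    rw [hA0]
    have h := det_gram_ne_zero g x₀ ((trivializationAt E (TangentSpace I) x₀).basisAt β hx₀e)
    simpa only [hbx] using h
  have hinv := fun j i ↦ Literature.Analysis.Calculus.hasFDerivAt_inv_apply hA hdet j i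
  -- the chart formula for the trace and its derivative
  have hprod := fun i j ↦ (hinv j i).mul (hκE i j).hasFDerivAt
  have hsum := HasFDerivAt.fun_sum (u := Finset.univ) fun i _ ↦
    HasFDerivAt.fun_sum (u := Finset.univ) fun j _ ↦ hprod i j
  have hloc : (fun y ↦ g.trace y (k y).toLinearMap₁₂) ∘ (extChartAt I x₀).symm =ᶠ[𝓝 (extChartAt
      I x₀ x₀)]
      fun z ↦ ∑ i ∈ Finset.univ, ∑ j ∈ Finset.univ,
        ((fun z ↦ (Matrix.of fun i j ↦ ((fun y ↦ g.val y ((trivializationAt E (TangentSpace I)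
            x₀).localFrame β i y) ((trivializationAt E (TangentSpace I) x₀).localFrame β j y)) ∘
          (extChartAt I x₀).symm) z)⁻¹ j i) *
          ((fun y ↦ k y ((trivializationAt E (TangentSpace I) x₀).localFrame β i y)
              ((trivializationAt E (TangentSpace I) x₀).localFrame β j y)) ∘ (extChartAt I
              x₀).symm)) z := by
    have hmem : ∀ᶠ z in 𝓝 (extChartAt I x₀ x₀),
        (extChartAt I x₀).symm z ∈ (trivializationAt E (TangentSpace I) x₀).baseSet :=
      h1s.continuousAt.preimage_mem_nhds (by
        rw [hxinv]
        exact (trivializationAt E (TangentSpace I) x₀).open_baseSet.mem_nhds hx₀e)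
    filter_upwards [hmem] with z hz'
    simp only [Function.comp_apply, Pi.mul_apply]
    exact trace_eq_sum_gram_inv_localFrame g β hz'
  have hF := hsum.congr_of_eventuallyEq hloc
  have hFd := hF.differentiableAt
  -- back on `M`: differentiability of the trace at `x₀`
  have hFM : MDifferentiableAt I 𝓘(ℝ, ℝ) (fun y ↦ g.trace y (k y).toLinearMap₁₂) x₀ := by
    have h1 : MDifferentiableAt I 𝓘(ℝ, ℝ)
        (((fun y ↦ g.trace y (k y).toLinearMap₁₂) ∘ (extChartAt I x₀).symm) ∘ extChartAt I x₀)
        x₀ :=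
      (mdifferentiableAt_iff_differentiableAt.2 hFd).comp x₀ (mdifferentiableAt_extChartAt hx₀)
    refine h1.congr_of_eventuallyEq ?_
    filter_upwards [(chartAt H x₀).open_source.mem_nhds hx₀] with y hy
    simp only [Function.comp_apply]
    rw [(extChartAt I x₀).left_inv (by rwa [extChartAt_source])]
  refine ⟨hFM, ?_⟩
  -- the derivative: evaluate the chart formula on `β d`
  rw [mvfderiv_apply_localFrame β hx₀ hFM d, hF.fderiv]
  simp only [FunLike.coe_sum, Finset.sum_apply, add_apply, FunLike.coe_smul, Pi.smul_apply,
    smul_eq_mul, neg_apply, ContinuousLinearMap.coe_comp, Function.comp_apply,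
    ContinuousLinearMap.proj_apply, ContinuousLinearMap.pi_apply]
  -- the pieces, back on `M`
  have hκ0 : ∀ i j, k ((extChartAt I x₀).symm (extChartAt I x₀ x₀))
      ((trivializationAt E (TangentSpace I) x₀).localFrame β i ((extChartAt I x₀).symm (extChartAt
          I x₀ x₀)))
      ((trivializationAt E (TangentSpace I) x₀).localFrame β j ((extChartAt I x₀).symm (extChartAt
          I x₀ x₀))) = k x₀ ((trivializationAt E (TangentSpace I) x₀).localFrame β i x₀)
          ((trivializationAt E (TangentSpace I) x₀).localFrame β j x₀) := by
    intro i j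
    rw [hxinv]
  have hAinv' : (Matrix.of fun i j ↦ g.val ((extChartAt I x₀).symm (extChartAt I x₀ x₀))
      ((trivializationAt E (TangentSpace I) x₀).localFrame β i ((extChartAt I x₀).symm (extChartAt
          I x₀ x₀)))
      ((trivializationAt E (TangentSpace I) x₀).localFrame β j ((extChartAt I x₀).symm (extChartAt
          I x₀ x₀))))⁻¹ =
      Matrix.diagonal fun i ↦ (g.val x₀ ((trivializationAt E (TangentSpace I) x₀).localFrame β i
          x₀) ((trivializationAt E (TangentSpace I) x₀).localFrame β i x₀))⁻¹ := by
    have h : (fun i j ↦ g.val ((extChartAt I x₀).symm (extChartAt I x₀ x₀))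
        ((trivializationAt E (TangentSpace I) x₀).localFrame β i ((extChartAt I x₀).symm
            (extChartAt I x₀ x₀)))
        ((trivializationAt E (TangentSpace I) x₀).localFrame β j ((extChartAt I x₀).symm
            (extChartAt I x₀ x₀)))) =
        fun i j ↦ g.val x₀ ((trivializationAt E (TangentSpace I) x₀).localFrame β i x₀)
            ((trivializationAt E (TangentSpace I) x₀).localFrame β j x₀) := by
      funext i j
      rw [hxinv]
    rw [h]
    have h2 := gram_inv_of_isOrthoᵢ g x₀ ((trivializationAt E (TangentSpace I) x₀).basisAt β hx₀e)
      hβ' hdβ'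
    simpa only [hbx] using h2
  have hC : ∀ i j, fderiv ℝ ((fun y ↦ k y ((trivializationAt E (TangentSpace I) x₀).localFrame β i
      y) ((trivializationAt E (TangentSpace I) x₀).localFrame β j y)) ∘ (extChartAt I x₀).symm)
      (extChartAt I x₀ x₀) (β d) =
      g.covDeriv₂ k x₀ ((trivializationAt E (TangentSpace I) x₀).localFrame β i x₀)
          ((trivializationAt E (TangentSpace I) x₀).localFrame β j x₀) ((trivializationAt E
          (TangentSpace I) x₀).localFrame β d x₀) +
        k x₀ (g.leviCivita ((trivializationAt E (TangentSpace I) x₀).localFrame β i) x₀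
            ((trivializationAt E (TangentSpace I) x₀).localFrame β d x₀)) ((trivializationAt E
            (TangentSpace I) x₀).localFrame β j x₀) +
        k x₀ ((trivializationAt E (TangentSpace I) x₀).localFrame β i x₀) (g.leviCivita
            ((trivializationAt E (TangentSpace I) x₀).localFrame β j) x₀ ((trivializationAt E
            (TangentSpace I) x₀).localFrame β d x₀)) := by
    intro i j
    have h := PseudoRiemannianMetric.covDeriv₂_apply_holds (g := g) hk (hs i) (hs j) (hs d)
    simp only [PseudoRiemannianMetric.covDeriv₂Aux] at h
    rw [← mvfderiv_apply_localFrame β hx₀ (hκ i j) d]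
    linarith
  have hΓ : ∀ p q, fderiv ℝ ((fun y ↦ g.val y ((trivializationAt E (TangentSpace I) x₀).localFrame
      β p y) ((trivializationAt E (TangentSpace I) x₀).localFrame β q y)) ∘ (extChartAt I x₀).symm)
      (extChartAt I x₀ x₀) (β d) =
      g.val x₀ (g.leviCivita ((trivializationAt E (TangentSpace I) x₀).localFrame β p) x₀
          ((trivializationAt E (TangentSpace I) x₀).localFrame β d x₀)) ((trivializationAt E
          (TangentSpace I) x₀).localFrame β q x₀) +
        g.val x₀ (g.leviCivita ((trivializationAt E (TangentSpace I) x₀).localFrame β q) x₀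
            ((trivializationAt E (TangentSpace I) x₀).localFrame β d x₀)) ((trivializationAt E
            (TangentSpace I) x₀).localFrame β p x₀) := by
    intro p q
    rw [← mvfderiv_apply_localFrame β hx₀ (hG p q) d,
      g.symm x₀ (g.leviCivita ((trivializationAt E (TangentSpace I) x₀).localFrame β q) x₀
          ((trivializationAt E (TangentSpace I) x₀).localFrame β d x₀)) ((trivializationAt E
          (TangentSpace I) x₀).localFrame β p x₀)]
    exact hcompat (hs d) (hs p) (hs q)
  -- expansion of `∇_{∂_d} ∂ₚ` in the orthogonal frame
  have hexp : ∀ p, g.leviCivita ((trivializationAt E (TangentSpace I) x₀).localFrame β p) x₀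
      ((trivializationAt E (TangentSpace I) x₀).localFrame β d x₀) =
      ∑ m, (g.val x₀ (g.leviCivita ((trivializationAt E (TangentSpace I) x₀).localFrame β p) x₀
          ((trivializationAt E (TangentSpace I) x₀).localFrame β d x₀)) ((trivializationAt E
          (TangentSpace I) x₀).localFrame β m x₀) /
        g.val x₀ ((trivializationAt E (TangentSpace I) x₀).localFrame β m x₀) ((trivializationAt E
            (TangentSpace I) x₀).localFrame β m x₀)) • (trivializationAt E (TangentSpace I)
            x₀).localFrame β m x₀ := by
    intro p
    have h := ((trivializationAt E (TangentSpace I) x₀).basisAt β hx₀e).sum_repr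
      (g.leviCivita ((trivializationAt E (TangentSpace I) x₀).localFrame β p) x₀ ((trivializationAt
          E (TangentSpace I) x₀).localFrame β d x₀))
    simp only [repr_eq_div_of_isOrthoᵢ _ hβ' hdβ', hbx] at h
    exact h.symm
  have hK1 : ∀ p q, k x₀ (g.leviCivita ((trivializationAt E (TangentSpace I) x₀).localFrame β p) x₀
      ((trivializationAt E (TangentSpace I) x₀).localFrame β d x₀)) ((trivializationAt E
      (TangentSpace I) x₀).localFrame β q x₀) =
      ∑ m, g.val x₀ (g.leviCivita ((trivializationAt E (TangentSpace I) x₀).localFrame β p) x₀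
          ((trivializationAt E (TangentSpace I) x₀).localFrame β d x₀)) ((trivializationAt E
          (TangentSpace I) x₀).localFrame β m x₀) /
        g.val x₀ ((trivializationAt E (TangentSpace I) x₀).localFrame β m x₀) ((trivializationAt E
            (TangentSpace I) x₀).localFrame β m x₀) * k x₀ ((trivializationAt E (TangentSpace I)
            x₀).localFrame β m x₀) ((trivializationAt E (TangentSpace I) x₀).localFrame β q x₀) :=
            by
    intro p q
    conv_lhs => rw [hexp p]
    simp only [map_sum, map_smul, FunLike.coe_sum, Finset.sum_apply, FunLike.coe_smul,
      Pi.smul_apply, smul_eq_mul]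
  have hK2 : ∀ p q, k x₀ ((trivializationAt E (TangentSpace I) x₀).localFrame β p x₀) (g.leviCivita
      ((trivializationAt E (TangentSpace I) x₀).localFrame β q) x₀ ((trivializationAt E
      (TangentSpace I) x₀).localFrame β d x₀)) =
      ∑ m, g.val x₀ (g.leviCivita ((trivializationAt E (TangentSpace I) x₀).localFrame β q) x₀
          ((trivializationAt E (TangentSpace I) x₀).localFrame β d x₀)) ((trivializationAt E
          (TangentSpace I) x₀).localFrame β m x₀) /
        g.val x₀ ((trivializationAt E (TangentSpace I) x₀).localFrame β m x₀) ((trivializationAt E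
            (TangentSpace I) x₀).localFrame β m x₀) * k x₀ ((trivializationAt E (TangentSpace I)
            x₀).localFrame β p x₀) ((trivializationAt E (TangentSpace I) x₀).localFrame β m x₀) :=
            by
    intro p q
    conv_lhs => rw [hexp q]
    simp only [map_sum, map_smul, smul_eq_mul]
  -- assemble with the cancellation lemma
  rw [← trace_deriv_algebra (fun i ↦ g.val x₀ ((trivializationAt E (TangentSpace I) x₀).localFrame
      β i x₀) ((trivializationAt E (TangentSpace I) x₀).localFrame β i x₀))
    (fun i j ↦ g.covDeriv₂ k x₀ ((trivializationAt E (TangentSpace I) x₀).localFrame β i x₀)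
        ((trivializationAt E (TangentSpace I) x₀).localFrame β j x₀) ((trivializationAt E
        (TangentSpace I) x₀).localFrame β d x₀))
    (fun i j ↦ k x₀ ((trivializationAt E (TangentSpace I) x₀).localFrame β i x₀) ((trivializationAt
        E (TangentSpace I) x₀).localFrame β j x₀))
    (fun p m ↦ g.val x₀ (g.leviCivita ((trivializationAt E (TangentSpace I) x₀).localFrame β p) x₀
        ((trivializationAt E (TangentSpace I) x₀).localFrame β d x₀)) ((trivializationAt E
        (TangentSpace I) x₀).localFrame β m x₀)), hAinv']
  refine Finset.sum_congr rfl fun i _ ↦ Finset.sum_congr rfl fun j _ ↦ ?_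
  rw [hκ0, hC, hK1, hK2, sum_sum_diagonal_mul, hΓ]
  ring

end Trace

end PseudoRiemannianMetric

end Literature.Geometry.Lorentzian

end
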